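import Mathlib
import Literature.Barriers.PneNP.CorrelationPolytopeXCLowerBoundGraph
import Literature.Barriers.PneNP.ExtendedFormulationLinearImage
import Summits.ValiantsHypothesis.ValiantsHypothesis.Theorems.FifoMatchingXcDivisionZmixFace
import HarnessLib

/-!
# PROP A — the CHAMBER CERTIFICATE: `3^h ≤ K · (r + 1) · 2^h` for every size-`r` extended formulation of
# `COR(K_h) + conv{q_1, …, q_K}` (a Minkowski passenger with few vertices cannot destroy the FMPTW / Kaibel–Weltge bound)

Theorems-side port (port hand val-port-1 g3, director-valiant g16 RULING R290 (1): the B-port of line `virtual_passenger` on crux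
stmt-ValiantsHypothesis-21181 needs PROP A in `Theorems/`; `--supports stmt-ValiantsHypothesis-21181 --as helper`) of §1, §3 and §4
of val-idea-7's crux workfile `Cruxes/NNLinearDegreeCofactorHard/Lines/xc_division.lean` (rev 4.1 @61de3b6b78b4; critic of record
val-idea-crit-3 g3, by-name PASS 2026-08-28 12:00Z), proof texts VERBATIM; DEFINITION-FREE: the four FMPTW witnesses `udInd a = 𝟙_a`,
`udPt b = 𝟙_b 𝟙_bᵀ`, `udMat a = 2 diag(𝟙_a) − 𝟙_a 𝟙_aᵀ`, `udRow a = flat (udMat a)` of the line's §3 are proof-local `let`s of the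
existential packaging `cor_udisj_data` (the only form PROP A consumes), so that no new `def` enters `Theorems/` (D-0009/D-0026).
Namespace = the earlier XcDivision port's (`…Theorems.FifoMatching.XcDivision`, ✓ `…FifoMatchingXcDivisionZmixFace`, whose
`dot_le_of_mem_convexHull` is reused by name).

MECHANISM (val-idea-7 g7–g8, LENS dual; «chamber pigeonhole»): `P + Q` has an extended formulation of size `r`; `P` carries
unique-disjointness data (points `v b ∈ P`, valid rows `c a · x ≤ d a` with slack positive when `a ∩ b = ∅` and zero when
`|a ∩ b| = 1`); `q : J → Q` is a HITTING family (every row functional attains its maximum over `Q` at some `q j` — automatic when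
`Q = conv{q j}`).  Lift row `a` to `P + Q` with right-hand side `d a + max_Q c a`; on the columns `v b + q j(a)` the passenger's gap
vanishes and the slack is the UDISJ slack; refine Yannakakis' rectangles (`HasEFOfSize.exists_cover_option`) by the chamber `j(a)` and
count disjoint pairs (Kaibel–Weltge, `three_pow_le_card_mul_two_pow_of_cover_univ`): `3^{|α|} ≤ |J| · (r + 1) · 2^{|α|}`
(`three_pow_le_of_hits`, `three_pow_le_of_add`).  With the explicit FMPTW data of `COR(n)` (`cor_udisj_data`: slack
`(1 − |a ∩ b|)²`, [cite: FioriniEtAl2015, §4.1 eq. (4), Lemma 6]) this is ★ `corPolytope_add_three_pow_le` /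
`corPolytope_add_hull_three_pow_le`, and in the graph currency `COR(K_h) = corPolytopeGraph ⊤`
(`corPolytope_eq_image_corPolytopeGraph_top`, `HasEFOfSize.image_linearEquiv_iff`) ★ `corPolytopeGraph_top_add_hull_three_pow_le`.

HONEST FRAMING: PROP A is one certificate of the located gap of COR-MINKOWSKI (a counterexample must have exponentially many
vertices); COR-MINKOWSKI / COR-VIRTUAL are OPEN; stmt-21181 `NNDivisionHard` is OPEN; `VP ≠ VNP` is NOT proved; nothing here is a
summit statement.
-/

set_option autoImplicit false

-- the mandated summit-side namespace repeats a component by design (single-problem summit)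
set_option linter.dupNamespace false

noncomputable section

open Matrix Finset
open scoped Pointwise

namespace Summit.ValiantsHypothesis.ValiantsHypothesis.Theorems.FifoMatching

namespace XcDivision

open Literature.Barriers.PneNP (HasEFOfSize three_pow_le_card_mul_two_pow_of_cover_univ
  corPolytope_eq_image_corPolytopeGraph_top)
open Literature.Combinatorics.Optimization (corPolytopeGraph)
open Literature.Combinatorics.Optimization.FixedSizePsdRank (vecOuter bvec corPolytope flat
  flat_dotProduct_vecOuter flat_dotProduct_le_of_mem_corPolytope)

/-! ## §0 Elementary helpers (xc_division §0, verbatim) -/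

/-- `⟨2 diag(u) - uuᵀ, x xᵀ⟩ = 2 Σ u_i x_i² - (Σ u_i x_i)²`. [cite: FioriniEtAl2015, §4.1 eq. (4)] -/
theorem quad_two_diag_sub_outer {n : ℕ} (u x : Fin n → ℝ) :
    ∑ i, ∑ j, (2 * (if i = j then 1 else 0) * u i - u i * u j) * (x i * x j) =
      2 * (∑ i, u i * (x i * x i)) - (∑ i, u i * x i) ^ 2 := by
  simp only [sub_mul, Finset.sum_sub_distrib]
  congr 1
  · rw [Finset.mul_sum]
    refine Finset.sum_congr rfl fun i _ => ?_
    rw [Finset.sum_eq_single i]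
    · simp; ring
    · intro j _ hji; simp [Ne.symm hji]
    · intro h; exact absurd (Finset.mem_univ i) h
  · rw [sq, Finset.sum_mul_sum]
    refine Finset.sum_congr rfl fun i _ => Finset.sum_congr rfl fun j _ => ?_
    ring

/-- the `bvec` of a decidable membership predicate is the `0/1` indicator. -/
theorem bvec_decide_apply {n : ℕ} (a : Finset (Fin n)) (i : Fin n) :
    bvec (fun i => decide (i ∈ a)) i = if i ∈ a then 1 else 0 := by
  by_cases h : i ∈ a <;> simp [bvec, h]

/-! ## §1 The chamber pigeonhole: unique-disjointness data on `P` survive a Minkowski passenger `Q` at the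
price of the number of generators of `Q` (xc_division §1, verbatim) -/

/-- **Chamber pigeonhole, hitting form** (the Q-uniform certificate).  `P + Q` has an extended formulation of
size `r`; `P` carries unique-disjointness data (points `v b ∈ P`, valid rows `c a · x ≤ d a` whose slack at `v b`
is positive when `a ∩ b = ∅` and zero when `|a ∩ b| = 1`); and `q : J → Q` is a HITTING FAMILY: every row functional
`c a` attains its maximum over `Q` at some `q j`.  Then `3^{|α|} ≤ |J| · (r + 1) · 2^{|α|}`.  Proof: lift row `a` to
`P + Q` with right-hand side `d a + max_Q c a`; on the columns `v b + q j(a)` the passenger's gap vanishes and the slack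
is the UDISJ slack; refine Yannakakis' rectangles by the chamber `j(a)` and count disjoint pairs
(`three_pow_le_card_mul_two_pow_of_cover_univ`). -/
theorem three_pow_le_of_hits {ι α J : Type} [Fintype ι] [Fintype α] [DecidableEq α] [Fintype J]
    {r : ℕ} {P Q : Set (ι → ℝ)} (h : HasEFOfSize (P + Q) r)
    (v : Finset α → ι → ℝ) (hv : ∀ b, v b ∈ P)
    (c : Finset α → ι → ℝ) (d : Finset α → ℝ) (hvalid : ∀ a, ∀ x ∈ P, c a ⬝ᵥ x ≤ d a)
    (hone : ∀ a b, c a ⬝ᵥ v b < d a → (a ∩ b).card ≠ 1)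
    (hdisj : ∀ a b, Disjoint a b → c a ⬝ᵥ v b < d a)
    (q : J → ι → ℝ) (hq : ∀ j, q j ∈ Q) (hhit : ∀ a, ∃ j, ∀ y ∈ Q, c a ⬝ᵥ y ≤ c a ⬝ᵥ q j) :
    3 ^ Fintype.card α ≤ Fintype.card J * (r + 1) * 2 ^ Fintype.card α := by
  classical
  choose jm hsQ using hhit
  -- columns `(b, j) ↦ v b + q j ∈ P + Q`, rows `a` with right-hand side `d a + c a · q (jm a)`
  let v' : Finset α × J → ι → ℝ := fun bj => v bj.1 + q bj.2
  have hv' : ∀ bj, v' bj ∈ P + Q := fun bj => Set.add_mem_add (hv bj.1) (hq bj.2)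
  have hvalid' : ∀ a, ∀ z ∈ P + Q, c a ⬝ᵥ z ≤ d a + c a ⬝ᵥ q (jm a) := by
    intro a z hz
    obtain ⟨x, hx, y, hy, rfl⟩ := Set.mem_add.1 hz
    rw [dotProduct_add]
    exact add_le_add (hvalid a x hx) (hsQ a y hy)
  obtain ⟨RA, RB, hin, hcov⟩ := h.exists_cover_option v' hv' c (fun a => d a + c a ⬝ᵥ q (jm a)) hvalid'
  -- refine Yannakakis' rectangles by the chamber of the row
  have key := three_pow_le_card_mul_two_pow_of_cover_univ (α := α)
    (Finset.univ : Finset (J × Option (Fin r)))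
    (fun ji => {a | a ∈ RA ji.2 ∧ jm a = ji.1}) (fun ji => {b | (b, ji.1) ∈ RB ji.2})
    (fun ji _ a ha b hb => by
      have hlt := hin ji.2 a ha.1 (b, ji.1) hb
      have hsplit : c a ⬝ᵥ v' (b, ji.1) = c a ⬝ᵥ v b + c a ⬝ᵥ q ji.1 := dotProduct_add _ _ _
      rw [hsplit] at hlt
      have hj : c a ⬝ᵥ q ji.1 = c a ⬝ᵥ q (jm a) := by rw [ha.2]
      exact hone a b (by linarith))
    (fun a b hab => by
      have hlt : c a ⬝ᵥ v' (b, jm a) < d a + c a ⬝ᵥ q (jm a) := by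
        show c a ⬝ᵥ (v b + q (jm a)) < _
        rw [dotProduct_add]
        linarith [hdisj a b hab]
      obtain ⟨i, ha, hb⟩ := hcov a (b, jm a) hlt
      exact ⟨(jm a, i), Finset.mem_univ _, ⟨ha, rfl⟩, hb⟩)
  rw [Finset.card_univ, Fintype.card_prod, Fintype.card_option, Fintype.card_fin] at key
  exact key

/-- **Chamber pigeonhole, vertex form**: if `Q ⊆ conv{q j}` with all `q j ∈ Q` then `{q j}` is a hitting family
(a linear functional on a polytope is maximised at a generator), so `3^{|α|} ≤ |J| · (r + 1) · 2^{|α|}`. -/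
theorem three_pow_le_of_add {ι α J : Type} [Fintype ι] [Fintype α] [DecidableEq α] [Fintype J]
    [Nonempty J] {r : ℕ} {P Q : Set (ι → ℝ)} (h : HasEFOfSize (P + Q) r)
    (v : Finset α → ι → ℝ) (hv : ∀ b, v b ∈ P)
    (c : Finset α → ι → ℝ) (d : Finset α → ℝ) (hvalid : ∀ a, ∀ x ∈ P, c a ⬝ᵥ x ≤ d a)
    (hone : ∀ a b, c a ⬝ᵥ v b < d a → (a ∩ b).card ≠ 1)
    (hdisj : ∀ a b, Disjoint a b → c a ⬝ᵥ v b < d a)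
    (q : J → ι → ℝ) (hq : ∀ j, q j ∈ Q) (hQ : Q ⊆ convexHull ℝ (Set.range q)) :
    3 ^ Fintype.card α ≤ Fintype.card J * (r + 1) * 2 ^ Fintype.card α := by
  classical
  refine three_pow_le_of_hits h v hv c d hvalid hone hdisj q hq fun a => ?_
  obtain ⟨j, -, hj⟩ :=
    Finset.exists_max_image Finset.univ (fun j => c a ⬝ᵥ q j) Finset.univ_nonempty
  exact ⟨j, fun y hy => dot_le_of_mem_convexHull _ (c a) _
    (by rintro _ ⟨j', rfl⟩; exact hj j' (Finset.mem_univ _)) y (hQ hy)⟩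

/-! ## §3 The unique-disjointness data of `COR(n)` (FMPTW Lemma 6; xc_division §3 with the witnesses proof-local) -/

/-- `Σ_i Σ_j diag(σ)_{ij} x_i x_j = Σ_i σ_i x_i²`. [folklore] -/
theorem diag_quad {n : ℕ} (σ x : Fin n → ℝ) :
    ∑ i, ∑ j, Matrix.diagonal σ i j * (x i * x j) = ∑ i, σ i * (x i * x i) := by
  refine Finset.sum_congr rfl fun i _ => ?_
  rw [Finset.sum_eq_single i]
  · rw [Matrix.diagonal_apply_eq]
  · intro j _ hji; rw [Matrix.diagonal_apply_ne _ (Ne.symm hji), zero_mul]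
  · intro hi; exact absurd (Finset.mem_univ i) hi

/-- **The FMPTW data of `COR(n)`, existential packaging** (the line's `ud_data` / `cor_udisj_data`, witnesses
`pt b = 𝟙_b 𝟙_bᵀ` and `cc a = ⟨2 diag(𝟙_a) - 𝟙_a 𝟙_aᵀ, ·⟩` proof-local): `pt b ∈ COR(n)`; `cc a ≤ 1` is valid on `COR(n)`;
its slack at `pt b` is `(1 - |a ∩ b|)²`; diagonal functionals evaluate to `Σ_{i∈b} σ_i` at `pt b`.
[cite: FioriniEtAl2015, §4.1 eq. (4), Lemma 6] -/
theorem cor_udisj_data (n : ℕ) :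
    ∃ (pt cc : Finset (Fin n) → Fin (n * n) → ℝ),
      (∀ b, pt b ∈ corPolytope n) ∧ (∀ a, ∀ x ∈ corPolytope n, cc a ⬝ᵥ x ≤ 1) ∧
      (∀ a b, 1 - cc a ⬝ᵥ pt b = (1 - ((a ∩ b).card : ℝ)) ^ 2) ∧
      (∀ (σ : Fin n → ℝ) (b : Finset (Fin n)), flat (Matrix.diagonal σ) ⬝ᵥ pt b = ∑ i ∈ b, σ i) := by
  classical
  -- the witnesses of xc_division §3: `udInd a = 𝟙_a`, `udPt b = 𝟙_b 𝟙_bᵀ`, `udMat a = 2 diag(𝟙_a) − 𝟙_a 𝟙_aᵀ`, `udRow a`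
  let udInd : Finset (Fin n) → Fin n → ℝ := fun a => bvec fun i => decide (i ∈ a)
  let udPt : Finset (Fin n) → Fin (n * n) → ℝ := fun b => vecOuter n (udInd b)
  let udMat : Finset (Fin n) → Matrix (Fin n) (Fin n) ℝ := fun a i j =>
    2 * (if i = j then 1 else 0) * udInd a i - udInd a i * udInd a j
  let udRow : Finset (Fin n) → Fin (n * n) → ℝ := fun a => flat (udMat a)
  have udInd_apply : ∀ (a : Finset (Fin n)) (i : Fin n), udInd a i = if i ∈ a then 1 else 0 :=
    fun a i => bvec_decide_apply a i
  have udInd_sq : ∀ (a : Finset (Fin n)) (i : Fin n), udInd a i * udInd a i = udInd a i := fun a i => by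
    rw [udInd_apply]; by_cases hi : i ∈ a <;> simp [hi]
  have udInd_inter : ∀ a b : Finset (Fin n), ∑ i, udInd a i * udInd b i = ((a ∩ b).card : ℝ) := by
    intro a b
    have : ∀ i, udInd a i * udInd b i = if i ∈ a ∩ b then 1 else 0 := fun i => by
      rw [udInd_apply, udInd_apply]
      by_cases ha : i ∈ a <;> by_cases hb : i ∈ b <;> simp [ha, hb]
    simp only [this]
    rw [Finset.sum_boole, Finset.filter_mem_eq_inter, Finset.univ_inter]
  have pt_mem : ∀ b : Finset (Fin n), udPt b ∈ corPolytope n := fun b =>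
    subset_convexHull ℝ _ ⟨fun i => decide (i ∈ b), rfl⟩
  have valid01 : ∀ (a : Finset (Fin n)) (x : Fin n → ℝ), (∀ i, x i = 0 ∨ x i = 1) →
      ∑ i, ∑ j, udMat a i j * (x i * x j) ≤ 1 := by
    intro a x hx
    show ∑ i, ∑ j, (2 * (if i = j then 1 else 0) * udInd a i - udInd a i * udInd a j) * (x i * x j) ≤ 1
    rw [quad_two_diag_sub_outer]
    have hsq : ∀ i, x i * x i = x i := fun i => by rcases hx i with h | h <;> simp [h]
    simp only [hsq]
    nlinarith [sq_nonneg (∑ i, udInd a i * x i - 1)]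
  have slack : ∀ a b : Finset (Fin n), 1 - udRow a ⬝ᵥ udPt b = (1 - ((a ∩ b).card : ℝ)) ^ 2 := by
    intro a b
    show 1 - flat (udMat a) ⬝ᵥ vecOuter n (udInd b) = _
    rw [flat_dotProduct_vecOuter]
    show 1 - ∑ i, ∑ j, (2 * (if i = j then 1 else 0) * udInd a i - udInd a i * udInd a j) *
      (udInd b i * udInd b j) = _
    rw [quad_two_diag_sub_outer]
    simp only [udInd_sq, udInd_inter]
    ring
  refine ⟨udPt, udRow, pt_mem, ?_, slack, ?_⟩
  · intro a y hy
    exact flat_dotProduct_le_of_mem_corPolytope hy ⟨(udMat a, 1), fun x hx => valid01 a x hx⟩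
  · intro σ b
    show flat (Matrix.diagonal σ) ⬝ᵥ vecOuter n (udInd b) = _
    rw [flat_dotProduct_vecOuter, diag_quad]
    simp only [udInd_apply, mul_ite, mul_one, mul_zero]
    rw [Finset.sum_ite_mem, Finset.univ_inter]
    exact Finset.sum_congr rfl fun i hi => if_pos hi

/-! ## §4 PROP A: `xc(COR(n) + Q) ≥ 1.5ⁿ / #vert(Q) - 1` (xc_division §4, verbatim) -/

/-- **PROP A (counting form).**  If `COR(n) + Q` has an extended formulation of size `r` and `Q` lies in the
convex hull of `K ≥ 1` of its points, then `3ⁿ ≤ K · (r + 1) · 2ⁿ`: a Minkowski passenger with few vertices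
cannot destroy the Fiorini–Massar–Pokutta–Tiwary–de Wolf / Kaibel–Weltge bound.  (`K = 1`, `Q` a point:
`corPolytope_three_pow_le`.) -/
theorem corPolytope_add_three_pow_le {n r K : ℕ} {Q : Set (Fin (n * n) → ℝ)}
    (h : HasEFOfSize (corPolytope n + Q) r) (q : Fin K → (Fin (n * n) → ℝ)) (hK : 0 < K)
    (hq : ∀ j, q j ∈ Q) (hQ : Q ⊆ convexHull ℝ (Set.range q)) :
    3 ^ n ≤ K * (r + 1) * 2 ^ n := by
  classical
  obtain ⟨pt, cc, pt_mem, cc_valid, slack, -⟩ := cor_udisj_data n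
  haveI : Nonempty (Fin K) := Fin.pos_iff_nonempty.1 hK
  have key := three_pow_le_of_add h pt pt_mem cc (fun _ => 1) cc_valid ?_ ?_ q hq hQ
  · simpa [Fintype.card_fin] using key
  · intro a b hlt hone
    have := slack a b
    rw [hone] at this
    norm_num at this
    linarith
  · intro a b hab
    have := slack a b
    rw [Finset.disjoint_iff_inter_eq_empty.1 hab, Finset.card_empty] at this
    norm_num at this
    linarith

/-- **PROP A (exponential form)**: `(3/2)ⁿ ≤ K · (r + 1)` — every polytope `Q` with at most `K` vertices has
`xc(COR(n) + Q) ≥ 1.5ⁿ / K - 1`. -/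
theorem corPolytope_add_xc_ge {n r K : ℕ} {Q : Set (Fin (n * n) → ℝ)}
    (h : HasEFOfSize (corPolytope n + Q) r) (q : Fin K → (Fin (n * n) → ℝ)) (hK : 0 < K)
    (hq : ∀ j, q j ∈ Q) (hQ : Q ⊆ convexHull ℝ (Set.range q)) :
    (3 / 2 : ℝ) ^ n ≤ K * (r + 1) := by
  have h3 := corPolytope_add_three_pow_le h q hK hq hQ
  have h2 : (0 : ℝ) < 2 ^ n := by positivity
  rw [div_pow, div_le_iff₀ h2]
  exact_mod_cast h3

/-- PROP A for `Q = conv{q j}` itself. -/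
theorem corPolytope_add_hull_three_pow_le {n r K : ℕ} (q : Fin K → (Fin (n * n) → ℝ)) (hK : 0 < K)
    (h : HasEFOfSize (corPolytope n + convexHull ℝ (Set.range q)) r) :
    3 ^ n ≤ K * (r + 1) * 2 ^ n :=
  corPolytope_add_three_pow_le h q hK (fun j => subset_convexHull ℝ _ ⟨j, rfl⟩) subset_rfl

/-- **PROP A in the graph currency `COR(K_h) = corPolytopeGraph ⊤`** (the currency in which the route's located
face of `NFP_n` lands, `AboulkerEtAl2019_gridCorCliqueFace`): `3^h ≤ K · (r + 1) · 2^h` for every extended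
formulation of size `r` of `COR(K_h) + conv{q_1, …, q_K}`. -/
theorem corPolytopeGraph_top_add_hull_three_pow_le {h r K : ℕ} (q : Fin K → (Fin h × Fin h → ℝ))
    (hK : 0 < K)
    (hyp : HasEFOfSize (corPolytopeGraph (⊤ : SimpleGraph (Fin h)) + convexHull ℝ (Set.range q)) r) :
    3 ^ h ≤ K * (r + 1) * 2 ^ h := by
  let e : (Fin h × Fin h → ℝ) ≃ₗ[ℝ] (Fin (h * h) → ℝ) :=
    LinearEquiv.funCongrLeft ℝ ℝ (finProdFinEquiv (m := h) (n := h)).symm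
  have himg : e '' (corPolytopeGraph (⊤ : SimpleGraph (Fin h)) + convexHull ℝ (Set.range q)) =
      corPolytope h + convexHull ℝ (Set.range (e ∘ q)) := by
    rw [Set.image_add, corPolytope_eq_image_corPolytopeGraph_top, Set.range_comp]
    congr 1
    exact e.toLinearMap.image_convexHull (Set.range q)
  have h' : HasEFOfSize (corPolytope h + convexHull ℝ (Set.range (e ∘ q))) r := by
    rw [← himg]; exact (HasEFOfSize.image_linearEquiv_iff e).2 hyp
  exact corPolytope_add_hull_three_pow_le (e ∘ q) hK h'

end XcDivision

end Summit.ValiantsHypothesis.ValiantsHypothesis.Theorems.FifoMatching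

end
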